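import Summits.ValiantsHypothesis.ValiantsHypothesis.Theorems.LacunarySymmetroidMatrixDescartesDoorA26WallBubblingBalanceCount

/-!
# `DoorA26` / line `wall_bubbling` — COPLANAR BALANCES: a balanced profile with at most eight touches uses at most two null directions

HONEST FRAMING.  Object-search cell `pub-symmetroid`, crux `Theses.LacunarySymmetroid.DoorA26` (stmt-ValiantsHypothesis-19979; OPEN, typed,
never asserted).  W2 seat val-sym-door-p1 g18, file #51; def-free helper for obligation (R) of `Cruxes/DoorA26/Lines/wall_bubbling.lean`, continuing
#47 `…FirstOrderDual` (a touch profile lifts unless BALANCED: `μ ≥ 0` on `J`, `Σ_j μ_j κ_j e^{δ_l τ_j} P(τ_j) = 0` for all six `l`) and #48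
`…BalanceCount` (`≥ 7` touches; `eq_zero_of_expEval_combination_eq_zero`).

WHAT IS HERE.  ★ `coplanar_of_balance_card_le_eight`: a balance supported on `J` with `|J| ≤ 8` (two distinct abscissae named) satisfies ONE non-trivial
linear relation `c₀ P₀₀ + c₁ P₀₁ + c₂ P₁₁ = 0` at every touch weighted by `μ_j κ_j` — the weighted touch matrices lie in a common PLANE of
`Sym₂(ℝ) ≅ ℝ^{1,2}`.  Proof: the three entry columns `(μ_j κ_j P(τ_j)_{ab})_j` are kernel vectors of the `6 × |J|` evaluation matrix; a combination
vanishing at two named abscissae exists (`3` unknowns, `2` equations: `LinearMap.ker_ne_bot_of_finrank_lt`) and is supported on `≤ 6` abscissae, hence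
zero.  ★ `nine_le_card_of_balance_of_indep`: if three touches with `μ κ ≠ 0` have linearly independent coordinate vectors `(P₀₀, P₀₁, P₁₁)` then
`9 ≤ |J|`.  `det_coord_rankOne`: for rank-one letters `ε_i (a_i, b_i)(a_i, b_i)ᵀ` the coordinate determinant is
`ε₁ε₂ε₃ (a₁b₂ − a₂b₁)(a₂b₃ − a₃b₂)(a₁b₃ − a₃b₁)` — non-zero iff the three null directions are pairwise distinct: a plane of `ℝ^{1,2}` meets the null cone
in at most two lines.  READING for (R): balanced profiles (the first-order residual) with `≤ 8` touches use `≤ 2` null directions; with three pairwise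
distinct touch directions they have `9` or `10` touches.  Nothing here bears on `DoorA26`, `DoorA34`, (W)/(M)/(R), `MatrixDescartes` (18050) or
`VP ≠ VNP`; registers unchanged.

[folklore] linear algebra (rank–nullity; a `3 × 3` Vandermonde-type identity); [this work] the packaging.
-/

-- `Summit.ValiantsHypothesis.ValiantsHypothesis.…` repeats a component by the D-0017 layout
-- (single-conjunct summit), which the `dupNamespace` linter flags; the name is mandated.
set_option linter.dupNamespace false

namespace Summit.ValiantsHypothesis.ValiantsHypothesis.Theorems.LacunarySymmetroidMatrixDescartes.WallBubbling

open Finset Filter Topology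

/-- **A balance with at most eight touches is COPLANAR.**  If `μ` is supported on a touch set `J` with `|J| ≤ 8` containing two distinct abscissae
`j₁ ≠ j₂`, and the six matrix balance equations `Σ_j μ_j κ_j e^{δ_l τ_j} P(τ_j) = 0` hold (exponents and abscissae strictly increasing), then ONE
non-trivial linear relation `c₀ P₀₀ + c₁ P₀₁ + c₂ P₁₁ = 0` holds at every touch weighted by `μ_j κ_j`: the weighted touch matrices lie in a common
plane of `Sym₂(ℝ) ≅ ℝ^{1,2}` (a plane meets the null cone in at most two lines: at most TWO null directions).  Proof: the three entry columns are
kernel vectors of the `6 × |J|` evaluation matrix; a combination vanishing at `j₁, j₂` (it exists: `3 > 2` unknowns) is supported on `≤ 6`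
abscissae, hence zero (`eq_zero_of_expEval_combination_eq_zero`). [this work] -/
theorem coplanar_of_balance_card_le_eight (δ : Fin 6 → ℝ) (hd : StrictMono δ) (S : Fin 6 → Matrix (Fin 2) (Fin 2) ℝ)
    (τ : Fin 21 → ℝ) (hτ : StrictMono τ) (κ : Fin 21 → ℝ) (J : Finset (Fin 21)) (hJ : J.card ≤ 8)
    {j₁ j₂ : Fin 21} (hj₁ : j₁ ∈ J) (hj₂ : j₂ ∈ J) (hne : j₁ ≠ j₂)
    (μ : Fin 21 → ℝ) (hμJ : ∀ j ∉ J, μ j = 0)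
    (hμ : ∀ l, ∑ j, (μ j * κ j * Real.exp (δ l * τ j)) • (∑ l', Real.exp (δ l' * τ j) • S l') = 0) :
    ∃ c : Fin 3 → ℝ, c ≠ 0 ∧ ∀ j, μ j * κ j *
      (c 0 * (∑ l', Real.exp (δ l' * τ j) • S l') 0 0 + c 1 * (∑ l', Real.exp (δ l' * τ j) • S l') 0 1
        + c 2 * (∑ l', Real.exp (δ l' * τ j) • S l') 1 1) = 0 := by
  classical
  set P : Fin 21 → Matrix (Fin 2) (Fin 2) ℝ := fun j => ∑ l', Real.exp (δ l' * τ j) • S l' with hP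
  -- the three entry columns `W k j = μ_j κ_j P_j(entry k)`
  let ent : Fin 3 → Fin 2 × Fin 2 := ![(0, 0), (0, 1), (1, 1)]
  let W : Fin 3 → Fin 21 → ℝ := fun k j => μ j * κ j * (P j) (ent k).1 (ent k).2
  have hWker : ∀ k l, ∑ j, W k j * Real.exp (δ l * τ j) = 0 := by
    intro k l
    have h := congrFun (congrFun (hμ l) (ent k).1) (ent k).2
    rw [Matrix.sum_apply, Matrix.zero_apply] at h
    rw [← h]
    refine Finset.sum_congr rfl fun j _ => ?_
    simp only [W, Matrix.smul_apply, smul_eq_mul]; ring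
  have hWJ : ∀ k, ∀ j ∉ J, W k j = 0 := fun k j hj => by simp only [W, hμJ j hj, zero_mul]
  -- a non-trivial combination vanishing at `j₁` and `j₂`
  let e : Fin 2 → Fin 21 := ![j₁, j₂]
  let A : Matrix (Fin 2) (Fin 3) ℝ := Matrix.of fun i k => W k (e i)
  have hker : LinearMap.ker (Matrix.mulVecLin A) ≠ ⊥ :=
    LinearMap.ker_ne_bot_of_finrank_lt (by simp)
  obtain ⟨c, hc, hc0⟩ := Submodule.exists_mem_ne_zero_of_ne_bot hker
  rw [LinearMap.mem_ker, Matrix.mulVecLin_apply] at hc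
  refine ⟨c, hc0, ?_⟩
  -- the combination `v = Σ_k c_k W_k` is a kernel vector supported on `J ∖ {j₁, j₂}`
  let v : Fin 21 → ℝ := fun j => ∑ k, c k * W k j
  have hv1 : v j₁ = 0 := by
    have := congrFun hc 0
    simp only [Matrix.mulVec, dotProduct, Matrix.of_apply, Pi.zero_apply, A, e, Matrix.cons_val_zero] at this
    show ∑ k, c k * W k j₁ = 0
    rw [← this]; refine Finset.sum_congr rfl fun k _ => mul_comm _ _
  have hv2 : v j₂ = 0 := by
    have := congrFun hc 1
    simp only [Matrix.mulVec, dotProduct, Matrix.of_apply, Pi.zero_apply, A, e, Matrix.cons_val_one,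
      Matrix.cons_val_zero] at this
    show ∑ k, c k * W k j₂ = 0
    rw [← this]; refine Finset.sum_congr rfl fun k _ => mul_comm _ _
  set J' : Finset (Fin 21) := (J.erase j₁).erase j₂ with hJ'
  have hJ'card : J'.card ≤ 6 := by
    have h1 : (J.erase j₁).card = J.card - 1 := Finset.card_erase_of_mem hj₁
    have h2 : J'.card = (J.erase j₁).card - 1 := Finset.card_erase_of_mem (Finset.mem_erase.2 ⟨hne.symm, hj₂⟩)
    omega
  have hvJ' : ∀ j ∉ J', v j = 0 := by
    intro j hj
    by_cases h1 : j = j₁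
    · rw [h1]; exact hv1
    by_cases h2 : j = j₂
    · rw [h2]; exact hv2
    have hjJ : j ∉ J := by
      intro hjJ; exact hj (Finset.mem_erase.2 ⟨h2, Finset.mem_erase.2 ⟨h1, hjJ⟩⟩)
    show ∑ k, c k * W k j = 0
    exact Finset.sum_eq_zero fun k _ => by rw [hWJ k j hjJ, mul_zero]
  have hvker : ∀ l, ∑ j, v j * Real.exp (δ l * τ j) = 0 := by
    intro l
    calc ∑ j, v j * Real.exp (δ l * τ j) = ∑ j, ∑ k, c k * (W k j * Real.exp (δ l * τ j)) := by
          refine Finset.sum_congr rfl fun j _ => ?_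
          show (∑ k, c k * W k j) * Real.exp (δ l * τ j) = _
          rw [Finset.sum_mul]; refine Finset.sum_congr rfl fun k _ => ?_; ring
      _ = ∑ k, ∑ j, c k * (W k j * Real.exp (δ l * τ j)) := Finset.sum_comm
      _ = ∑ k, c k * ∑ j, W k j * Real.exp (δ l * τ j) := by
          refine Finset.sum_congr rfl fun k _ => ?_; rw [Finset.mul_sum]
      _ = 0 := Finset.sum_eq_zero fun k _ => by rw [hWker k l, mul_zero]
  have hv0 := eq_zero_of_expEval_combination_eq_zero δ hd τ hτ J' hJ'card v hvJ' hvker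
  intro j
  have := hv0 j
  simp only [v, W, ent, Fin.sum_univ_three, Matrix.cons_val_zero, Matrix.cons_val_one, Matrix.cons_val_two,
    Matrix.head_cons, Matrix.tail_cons] at this
  rw [← this]; ring

/-- **Three independent touch matrices force at least nine touches.**  In a balance (as above) suppose three abscissae `j₁, j₂, j₃ ∈ J` carry non-zero
weights `μ κ ≠ 0` and touch matrices `P(τ_{j_i})` whose coordinate vectors `(P₀₀, P₀₁, P₁₁)` are linearly independent (the `3 × 3` coordinate
determinant is non-zero — e.g. three rank-one letters with pairwise non-parallel null directions); then `9 ≤ |J|`. [this work] -/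
theorem nine_le_card_of_balance_of_indep (δ : Fin 6 → ℝ) (hd : StrictMono δ) (S : Fin 6 → Matrix (Fin 2) (Fin 2) ℝ)
    (τ : Fin 21 → ℝ) (hτ : StrictMono τ) (κ : Fin 21 → ℝ) (J : Finset (Fin 21))
    (g : Fin 3 → Fin 21) (hg : Function.Injective g) (hgJ : ∀ i, g i ∈ J)
    (μ : Fin 21 → ℝ) (hμJ : ∀ j ∉ J, μ j = 0) (hμg : ∀ i, μ (g i) * κ (g i) ≠ 0)
    (hindep : (Matrix.of fun i k => (![(∑ l', Real.exp (δ l' * τ (g i)) • S l') 0 0,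
        (∑ l', Real.exp (δ l' * τ (g i)) • S l') 0 1, (∑ l', Real.exp (δ l' * τ (g i)) • S l') 1 1] : Fin 3 → ℝ) k).det ≠ 0)
    (hμ : ∀ l, ∑ j, (μ j * κ j * Real.exp (δ l * τ j)) • (∑ l', Real.exp (δ l' * τ j) • S l') = 0) :
    9 ≤ J.card := by
  classical
  by_contra hlt
  have hJ : J.card ≤ 8 := by omega
  obtain ⟨c, hc0, hc⟩ := coplanar_of_balance_card_le_eight δ hd S τ hτ κ J hJ (hgJ 0) (hgJ 1)
    (fun h => by have := hg h; exact absurd this (by decide)) μ hμJ hμ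
  -- the relation at the three independent touches: the coordinate matrix kills `c`
  set B : Matrix (Fin 3) (Fin 3) ℝ := Matrix.of fun i k => (![(∑ l', Real.exp (δ l' * τ (g i)) • S l') 0 0,
        (∑ l', Real.exp (δ l' * τ (g i)) • S l') 0 1, (∑ l', Real.exp (δ l' * τ (g i)) • S l') 1 1] : Fin 3 → ℝ) k with hB
  have hBc : Matrix.mulVec B c = 0 := by
    funext i
    have h := hc (g i)
    have hrel : c 0 * (∑ l', Real.exp (δ l' * τ (g i)) • S l') 0 0 + c 1 * (∑ l', Real.exp (δ l' * τ (g i)) • S l') 0 1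
        + c 2 * (∑ l', Real.exp (δ l' * τ (g i)) • S l') 1 1 = 0 := by
      rcases mul_eq_zero.1 h with h' | h'
      · exact absurd h' (hμg i)
      · exact h'
    simp only [Matrix.mulVec, dotProduct, Matrix.of_apply, Pi.zero_apply, B, Fin.sum_univ_three, Matrix.cons_val_zero,
      Matrix.cons_val_one, Matrix.cons_val_two, Matrix.head_cons, Matrix.tail_cons]
    linarith
  exact hindep (Matrix.exists_mulVec_eq_zero_iff.1 ⟨c, hc0, hBc⟩)


/-- **Coordinate determinant of three rank-one symmetric letters** `ε_i (a_i, b_i)(a_i, b_i)ᵀ` (rows `ε_i (a_i², a_i b_i, b_i²)`):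
`ε₁ ε₂ ε₃ (a₁b₂ − a₂b₁)(a₂b₃ − a₃b₂)(a₁b₃ − a₃b₁)`. [folklore] -/
theorem det_coord_rankOne (ε a b : Fin 3 → ℝ) :
    (Matrix.of fun i k => (![ε i * a i ^ 2, ε i * (a i * b i), ε i * b i ^ 2] : Fin 3 → ℝ) k).det
      = ε 0 * ε 1 * ε 2 * ((a 0 * b 1 - a 1 * b 0) * (a 1 * b 2 - a 2 * b 1) * (a 0 * b 2 - a 2 * b 0)) := by
  simp only [Matrix.det_fin_three, Matrix.of_apply, Matrix.cons_val_zero, Matrix.cons_val_one, Matrix.cons_val_two,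
    Matrix.head_cons, Matrix.tail_cons]
  ring


end Summit.ValiantsHypothesis.ValiantsHypothesis.Theorems.LacunarySymmetroidMatrixDescartes.WallBubbling
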